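import Literature.AlgebraicGeometry.Resolution.QuadraticTransformAlongPrime
import Literature.AlgebraicGeometry.Resolution.BlowupChartRsop
import Literature.AlgebraicGeometry.Resolution.RegularSystemOfParameters
import Mathlib.RingTheory.DiscreteValuationRing.TFAE
import Mathlib.RingTheory.Valuation.ValuationRing
import HarnessLib

/-!
# The order valuation of a regular local ring, realised in its fraction field

Line `birth` of crux `SharpStrata.SepExcModels` (stmt-ResolutionOfSingularities-16828,
`Cruxes/SepExcModels/Lines/birth.lean`), lead c1, helper file for the tool stub (T6, ring form)
`stub_sepAbhyankarPlace_of_model` (the converse of the valuative criterion).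

Let `(S, 𝔪)` be a regular local ring of dimension `d ≥ 1` with fraction field `K` and let
`x = (x_1, …, x_d)` be a regular system of parameters. The **order valuation** of `S` is the
discrete valuation ring `O = S[𝔪/x_1]_{(x_1)}` of `K`: the chart `T = (S[𝔪t])_{(x_1 t)}` of the
blowing up of the closed point is a Noetherian domain inside `K` (`chartToField`,
`QuadraticTransformAlongPrime.lean`), its exceptional ideal `(x_1)` is prime with quotient the
polynomial ring `κ(S)[T_2, …, T_d]` (`chartQuotEquiv`, `BlowupChartRsop.lean`, for the
quasi-regular sequence `x`, `isQuasiRegular_regularSystemOfParameters`), so the local ring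
`T_{(x_1)}` is a Noetherian local domain with principal maximal ideal, i.e. a discrete valuation
ring (`IsDiscreteValuationRing.TFAE`), realised as a valuation subring `O` of `K = Frac T`.
It dominates `S`, and its residue field `κ(O) = Frac(T/(x_1)) = κ(S)(T_2, …, T_d)` is purely
transcendental of transcendence degree `d - 1` over `κ(S)`, in particular formally smooth.

* `exists_valuationSubring_equiv` — a valuation ring `V` with `Frac V = K` is (isomorphic to) a
  valuation subring of `K`.
* `exists_valuationSubring_of_span_singleton` — for a Noetherian domain `T ⊆ K = Frac T` and a
  non-zero principal prime `𝔭 = (t)`: a valuation subring `O ⊇ T` of `K` with `𝔭 ⊆ 𝔪_O` and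
  `κ(O) = Frac(T/𝔭)`.
* `chartToField_injective`, `isFractionRing_chart` — the chart ring of the blowing up of an
  ideal of a domain `S` embeds into `K = Frac S` with fraction field `K`.
* `exists_chartQuotAlgEquiv`, `isPrime_excIdeal` — `T/(x_1) ≅ κ(S)[T_j : j ≠ 1]` over `κ(S)`.
* `exists_orderValuation` — **the order valuation**: a valuation subring `O` of `K` and a map
  `ψ : S → O` over `K`, dominating `S`; `κ(O)/κ(S)` formally smooth of transcendence degree `d - 1`.

## Sources

* O. Zariski, P. Samuel, *Commutative Algebra* II (1960), Ch. VI §14 (prime divisors; the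
  `𝔪`-adic prime divisor of a regular local ring), Appendix 5. [ZariskiSamuel1960]
* S. S. Abhyankar, *Ramification theoretic methods in algebraic geometry* (1959), §3. [Abhyankar1959]
* The Stacks Project, Tag 0BIQ (the exceptional divisor of the blowing up in a regular
  sequence is a polynomial ring over the centre). [StacksProject]
-/

noncomputable section

-- single-problem summit: the doubled namespace component `ResolutionOfSingularities` is forced
set_option linter.dupNamespace false

open IsLocalRing Literature.AlgebraicGeometry.Resolution

namespace Summit.ResolutionOfSingularities.ResolutionOfSingularities.Theorems.SepExcModels.ModelValuationOrder


/-! ## Valuation rings with fraction field `K` as valuation subrings of `K` -/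

/-- **A valuation ring `V` with `Frac V = K` is a valuation subring of `K`**: the image of `V`
in `K` is a valuation subring `O` (every `x ∈ K` has `x` or `x⁻¹` integral over `V`,
`ValuationRing.isInteger_or_isInteger`), and `V ≅ O` over `K`. [folklore] -/
theorem exists_valuationSubring_equiv (V K : Type) [CommRing V] [IsDomain V] [ValuationRing V]
    [Field K] [Algebra V K] [IsFractionRing V K] :
    ∃ (O : ValuationSubring K) (e : V ≃+* O), ∀ v : V, ((e v : O) : K) = algebraMap V K v := by
  let O : ValuationSubring K :=
    ValuationSubring.ofSubring (algebraMap V K).range fun x => by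
      rcases ValuationRing.isInteger_or_isInteger V x with ⟨y, hy⟩ | ⟨y, hy⟩
      exacts [Or.inl ⟨y, hy⟩, Or.inr ⟨y, hy⟩]
  have hmem : ∀ x : K, x ∈ O ↔ ∃ v : V, algebraMap V K v = x := fun x => Iff.rfl
  let e : V ≃+* O :=
    RingEquiv.ofBijective ((algebraMap V K).codRestrict O fun v => (hmem _).mpr ⟨v, rfl⟩)
      ⟨fun _ _ h => IsFractionRing.injective V K (congrArg Subtype.val h),
        fun ⟨x, hx⟩ => by
          obtain ⟨v, hv⟩ := (hmem x).mp hx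
          exact ⟨v, Subtype.ext hv⟩⟩
  exact ⟨O, e, fun v => rfl⟩

/-! ## The discrete valuation ring of a principal prime of a Noetherian domain -/

section PrincipalPrime

variable {T K : Type} [CommRing T] [IsDomain T] [IsNoetherianRing T] [Field K] [Algebra T K]
  [IsFractionRing T K]

/-- **The local ring at a non-zero principal prime of a Noetherian domain is a discrete
valuation ring, realised in the fraction field.** For `T ⊆ K = Frac T` Noetherian and
`𝔭 = (t) ≠ 0` prime, `T_𝔭` is a Noetherian local domain whose maximal ideal `t T_𝔭` is
principal and non-zero, hence a discrete valuation ring (`IsDiscreteValuationRing.TFAE`); its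
image `O ⊆ K` is a valuation subring containing `T`, with `𝔭 ⊆ 𝔪_O`, and residue field
`κ(O) = Frac(T/𝔭)` (Mathlib: `κ(𝔭) = Frac(T/𝔭)`). [folklore] -/
theorem exists_valuationSubring_of_span_singleton (t : T) (ht : t ≠ 0) (𝔭 : Ideal T)
    [𝔭.IsPrime] (h𝔭 : 𝔭 = Ideal.span {t}) :
    ∃ (O : ValuationSubring K) (ψ : T →+* O) (_ : ∀ b : T, (ψ b : K) = algebraMap T K b)
      (hdom : 𝔭 ≤ (maximalIdeal O).comap ψ),
      @IsFractionRing (T ⧸ 𝔭) _ (ResidueField O) _ (Ideal.quotientMap (maximalIdeal O) ψ hdom).toAlgebra := by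
  classical
  subst h𝔭
  set 𝔭 : Ideal T := Ideal.span {t} with h𝔭
  set O' := Localization.AtPrime 𝔭 with hO'
  -- `T_𝔭` is a Noetherian local domain with principal non-zero maximal ideal: a DVR
  haveI : IsNoetherianRing O' := IsLocalization.isNoetherianRing 𝔭.primeCompl O' inferInstance
  have hinjT : Function.Injective (algebraMap T O') :=
    IsLocalization.injective O' 𝔭.primeCompl_le_nonZeroDivisors
  have hmax : maximalIdeal O' = Ideal.span {algebraMap T O' t} := by
    rw [← IsLocalization.AtPrime.map_eq_maximalIdeal 𝔭 O']
    show Ideal.map (algebraMap T O') (Ideal.span {t}) = _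
    rw [Ideal.map_span, Set.image_singleton]
  have hnf : ¬ IsField O' := by
    rw [IsLocalRing.isField_iff_maximalIdeal_eq, hmax, Ideal.span_singleton_eq_bot]
    exact fun h0 => ht (hinjT (by rw [h0, map_zero]))
  have hprinc : (maximalIdeal O').IsPrincipal := ⟨⟨algebraMap T O' t, by rw [hmax]⟩⟩
  haveI hV : ValuationRing O' := ((IsDiscreteValuationRing.TFAE O' hnf).out 4 1).mp hprinc
  -- `T_𝔭 → K`, making `K = Frac T_𝔭`
  have hunit : ∀ s : 𝔭.primeCompl, IsUnit (algebraMap T K s) := fun s =>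
    IsLocalization.map_units K ⟨(s : T), 𝔭.primeCompl_le_nonZeroDivisors s.2⟩
  letI algO'K : Algebra O' K := (IsLocalization.lift (M := 𝔭.primeCompl) (S := O') hunit).toAlgebra
  haveI : IsScalarTower T O' K :=
    IsScalarTower.of_algebraMap_eq fun b => (IsLocalization.lift_eq hunit b).symm
  haveI : IsFractionRing O' K :=
    IsFractionRing.isFractionRing_of_isDomain_of_isLocalization 𝔭.primeCompl O' K
  -- the valuation subring and the map
  obtain ⟨O, e, he⟩ := exists_valuationSubring_equiv O' K
  let ψ : T →+* O := e.toRingHom.comp (algebraMap T O')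
  have hψ : ∀ b : T, (ψ b : K) = algebraMap T K b := fun b => by
    show ((e (algebraMap T O' b) : O) : K) = algebraMap T K b
    rw [he, ← IsScalarTower.algebraMap_apply]
  have hdom : 𝔭 ≤ (maximalIdeal O).comap ψ := by
    intro b hb
    rw [Ideal.mem_comap]
    have hb' : algebraMap T O' b ∈ maximalIdeal O' := by
      rw [← IsLocalization.AtPrime.map_eq_maximalIdeal 𝔭 O']
      exact Ideal.mem_map_of_mem _ hb
    rw [← map_ringEquiv_maximalIdeal e]
    exact Ideal.mem_map_of_mem _ hb'
  refine ⟨O, ψ, hψ, hdom, ?_⟩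
  -- residue fields: `κ(O) ≅ κ(O') = κ(𝔭) = Frac(T/𝔭)`
  letI algQ : Algebra (T ⧸ 𝔭) (ResidueField O) :=
    (Ideal.quotientMap (maximalIdeal O) ψ hdom).toAlgebra
  have hcomm : ∀ b : T, ResidueField.mapEquiv e (algebraMap (T ⧸ 𝔭) 𝔭.ResidueField
      (Ideal.Quotient.mk 𝔭 b)) = algebraMap (T ⧸ 𝔭) (ResidueField O) (Ideal.Quotient.mk 𝔭 b) := by
    intro b
    rw [Ideal.algebraMap_quotient_residueField_mk,
      IsScalarTower.algebraMap_apply T O' 𝔭.ResidueField, ResidueField.algebraMap_eq,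
      ResidueField.mapEquiv_apply, ResidueField.map_residue]
    rfl
  let eκ : 𝔭.ResidueField ≃ₐ[T ⧸ 𝔭] ResidueField O :=
    AlgEquiv.ofRingEquiv (f := ResidueField.mapEquiv e) fun x => by
      obtain ⟨b, rfl⟩ := Ideal.Quotient.mk_surjective x
      exact hcomm b
  exact IsLocalization.isLocalization_of_algEquiv (nonZeroDivisors (T ⧸ 𝔭)) eκ

end PrincipalPrime

/-! ## The chart of the blowing up of a domain inside its fraction field -/

section ChartInField

variable {S K : Type} [CommRing S] [Field K] [Algebra S K] [IsFractionRing S K]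
  {d : ℕ} (c : Fin d → S) (i : Fin d) (hci : algebraMap S K (c i) ≠ 0)

/-- **The chart ring `(S[It])_{(x_i t)}` of a domain embeds into `K = Frac S`** by
`chartToField` (`b = φ(r)/φ(x_i)^k ↦ r / x_i^k`): if `r / x_i^k = 0` then `r = 0`, and `φ(x_i)`
is a non-zero-divisor of the chart (Stacks 07Z3 (1)). [cite: StacksProject, Tag 0804] -/
theorem chartToField_injective :
    Function.Injective (chartToField c i (algebraMap S K) hci) := by
  rw [injective_iff_map_eq_zero]
  intro b hb
  obtain ⟨k, r, hkr⟩ := exists_pow_mul_eq_reesChartBase c i b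
  have h1 : algebraMap S K r = 0 := by
    rw [← chartToField_reesChartBase c i (algebraMap S K) hci r, ← hkr, map_mul, hb, mul_zero]
  have hr : r = 0 := (injective_iff_map_eq_zero _).mp (IsFractionRing.injective S K) r h1
  rw [hr, map_zero] at hkr
  have hnzd : chartBase c i (c i) ^ k ∈ nonZeroDivisors (chartRing c i) :=
    Submonoid.pow_mem _ (reesChartBase_mem_nonZeroDivisors (I := Ideal.span (Set.range c)) (c i)
      (Ideal.mem_span_range_self (f := c) (x := i))) k
  exact ((mem_nonZeroDivisors_iff (M₀ := chartRing c i)).mp hnzd).1 b hkr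

include hci in
/-- The chart ring of the blowing up of a domain is a domain (it sits inside `Frac S`).
[cite: StacksProject, Tag 0804] -/
theorem isDomain_chart : IsDomain (chartRing c i) :=
  Function.Injective.isDomain _ (chartToField_injective c i hci)

omit [IsFractionRing S K] in
include hci in
/-- `φ(x_i) ≠ 0` in the chart ring (its image in `K` is `x_i ≠ 0`). [folklore] -/
theorem chartBase_ne_zero : chartBase c i (c i) ≠ 0 := fun h =>
  hci (by rw [← chartToField_reesChartBase c i (algebraMap S K) hci (c i)]; exact
    (congrArg (chartToField c i (algebraMap S K) hci) h).trans (map_zero _))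

/-- **`Frac((S[It])_{(x_i t)}) = K`**: through `chartToField` the chart ring has fraction field
`K = Frac S` (it contains the image of `S`). [cite: StacksProject, Tag 0804] -/
theorem isFractionRing_chart :
    @IsFractionRing (chartRing c i) _ K _ (chartToField c i (algebraMap S K) hci).toAlgebra := by
  letI := (chartToField c i (algebraMap S K) hci).toAlgebra
  haveI : FaithfulSMul (chartRing c i) K :=
    (faithfulSMul_iff_algebraMap_injective _ K).mpr (chartToField_injective c i hci)
  refine IsFractionRing.of_field (chartRing c i) K fun z => ?_
  obtain ⟨a, b, -, rfl⟩ := IsFractionRing.div_surjective (A := S) z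
  refine ⟨chartBase c i a, chartBase c i b, ?_⟩
  show _ = chartToField c i (algebraMap S K) hci (chartBase c i a) /
    chartToField c i (algebraMap S K) hci (chartBase c i b)
  rw [chartToField_reesChartBase, chartToField_reesChartBase]

end ChartInField

/-! ## The exceptional prime of the chart of the blowing up of the closed point -/

section Regular

variable {S : Type} [CommRing S] [IsRegularLocalRing S] {d : ℕ}
  (hd : (maximalIdeal S).spanFinrank = d) (c : Fin d → S)
  (hc : Ideal.span (Set.range c) = maximalIdeal S) (i : Fin d)

include hd hc in
/-- A member of a regular system of parameters is non-zero. [cite: Matsumura1987, Thm. 14.2] -/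
theorem rsop_ne_zero : c i ≠ 0 := by
  intro h
  have := not_mem_span_image_of_not_mem hd c hc (S := ∅) (i := i) (Set.notMem_empty i)
  rw [Set.image_empty, Ideal.span_empty, h] at this
  exact this (Submodule.zero_mem ⊥)

/-- The chart isomorphism on constants, after identifying `S/(x) = S/𝔪 = κ(S)`:
`s̄ ↦ φ(s) mod x_i`. [folklore] -/
theorem chartQuotEquiv_mapEquiv_C (s : S) :
    chartQuotEquiv c i (isQuasiRegular_regularSystemOfParameters hd c hc)
      (MvPolynomial.mapEquiv {j : Fin d // j ≠ i} (Ideal.quotEquivOfEq hc.symm)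
        (MvPolynomial.C (Ideal.Quotient.mk _ s))) = Ideal.Quotient.mk _ (chartBase c i s) := by
  have h1 : MvPolynomial.mapEquiv {j : Fin d // j ≠ i} (Ideal.quotEquivOfEq hc.symm)
      (MvPolynomial.C (Ideal.Quotient.mk _ s)) = MvPolynomial.C (Ideal.Quotient.mk _ s) :=
    MvPolynomial.map_C _ _
  rw [h1, chartQuotEquiv_apply, chartQuotMap_C]

include hd hc in
/-- **`T/(x_i) ≅ κ(S)[T_j : j ≠ i]` over `κ(S)`** for the chart `T = (S[𝔪t])_{(x_i t)}` of the
blowing up of the closed point of a regular local ring `S` with regular system of parameters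
`x` (a quasi-regular sequence, `isQuasiRegular_regularSystemOfParameters`; `chartQuotEquiv`,
Stacks 0BIQ): the `κ(S)`-algebra structure `κ(S) = S/𝔪 → T/(x_i)` is induced by `φ : S → T`
(`φ(𝔪) ⊆ (x_i)`), and the isomorphism is one of `κ(S)`-algebras. [cite: StacksProject, Tag 0BIQ] -/
theorem exists_chartQuotAlgEquiv :
    ∃ f : S ⧸ maximalIdeal S →+* chartRing c i ⧸ Ideal.span {chartBase c i (c i)},
      (∀ s : S, f (Ideal.Quotient.mk _ s) = Ideal.Quotient.mk _ (chartBase c i s)) ∧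
      (letI := f.toAlgebra
       Nonempty (MvPolynomial {j : Fin d // j ≠ i} (S ⧸ maximalIdeal S) ≃ₐ[S ⧸ maximalIdeal S]
        chartRing c i ⧸ Ideal.span {chartBase c i (c i)})) := by
  let f : S ⧸ maximalIdeal S →+* chartRing c i ⧸ Ideal.span {chartBase c i (c i)} :=
    Ideal.Quotient.lift (maximalIdeal S) ((Ideal.Quotient.mk _).comp (chartBase c i)) fun s hs => by
      rw [RingHom.comp_apply, Ideal.Quotient.eq_zero_iff_mem]
      rw [← hc] at hs
      exact reesChartBase_mem_span_of_mem c i hs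
  have hf : ∀ s : S, f (Ideal.Quotient.mk _ s) = Ideal.Quotient.mk _ (chartBase c i s) :=
    fun s => rfl
  letI := f.toAlgebra
  refine ⟨f, hf, ⟨AlgEquiv.ofRingEquiv
    (f := (MvPolynomial.mapEquiv {j : Fin d // j ≠ i} (Ideal.quotEquivOfEq hc.symm)).trans
      (chartQuotEquiv c i (isQuasiRegular_regularSystemOfParameters hd c hc))) fun x => ?_⟩⟩
  obtain ⟨s, rfl⟩ := Ideal.Quotient.mk_surjective x
  exact chartQuotEquiv_mapEquiv_C hd c hc i s

include hd hc in
/-- The exceptional ideal `(x_i)` of the chart `T` is prime (`T/(x_i)` is a polynomial ring over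
the field `κ(S)`). [cite: StacksProject, Tag 0BIQ] -/
theorem isPrime_excIdeal : (Ideal.span {chartBase c i (c i)}).IsPrime := by
  haveI : IsDomain (S ⧸ maximalIdeal S) := Ideal.Quotient.isDomain _
  obtain ⟨f, -, ⟨e⟩⟩ := exists_chartQuotAlgEquiv hd c hc i
  letI := f.toAlgebra
  haveI : IsDomain (chartRing c i ⧸ Ideal.span {chartBase c i (c i)}) :=
    Function.Injective.isDomain e.symm.toRingEquiv.toRingHom e.symm.injective
  exact (Ideal.Quotient.isDomain_iff_prime _).mp inferInstance

end Regular

/-! ## The order valuation -/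

/-- **The order valuation of a regular local ring of positive dimension.** Let `(S, 𝔪)` be a
regular local ring with `𝔪 ≠ 0` and fraction field `K`. Then there is a valuation subring `O`
of `K` and a ring map `ψ : S → O` over `K` with `𝔪 ⊆ 𝔪_O` (domination) such that the residue
field `κ(O)` is formally smooth over `κ(S)` of transcendence degree `dim S - 1`: `O` is the
discrete valuation ring `S[𝔪/x_1]_{(x_1)}` of the first quadratic transform (`x` a regular
system of parameters), whose residue field is the rational function field
`κ(S)(T_2, …, T_d) = Frac(κ(S)[T_2, …, T_d])`. [cite: ZariskiSamuel1960, Ch. VI §14 and Appendix 5] -/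
theorem exists_orderValuation (S K : Type) [CommRing S] [IsRegularLocalRing S] [Field K]
    [Algebra S K] [IsFractionRing S K] (hS : IsLocalRing.maximalIdeal S ≠ ⊥) :
    ∃ (O : ValuationSubring K) (ψ : S →+* O) (_ : ∀ s : S, (ψ s : K) = algebraMap S K s)
      (hdom : IsLocalRing.maximalIdeal S ≤ (IsLocalRing.maximalIdeal O).comap ψ),
      @Algebra.FormallySmooth (S ⧸ IsLocalRing.maximalIdeal S) (IsLocalRing.ResidueField O) _ _
          (Ideal.quotientMap (IsLocalRing.maximalIdeal O) ψ hdom).toAlgebra ∧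
        @Algebra.trdeg (S ⧸ IsLocalRing.maximalIdeal S) (IsLocalRing.ResidueField O) _ _
          (Ideal.quotientMap (IsLocalRing.maximalIdeal O) ψ hdom).toAlgebra + 1 =
            (IsLocalRing.maximalIdeal S).spanFinrank := by
  classical
  haveI : IsDomain S := isDomain_of_isRegularLocalRing S
  obtain ⟨c, hc⟩ := exists_regularSystemOfParameters (R := S)
  have hd : (maximalIdeal S).spanFinrank = (maximalIdeal S).spanFinrank := rfl
  -- `d ≥ 1`
  have hd0 : 0 < (maximalIdeal S).spanFinrank := by
    by_contra h0
    have h0' : (maximalIdeal S).spanFinrank = 0 := by omega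
    apply hS
    rw [← hc, Ideal.span_eq_bot]
    rintro _ ⟨j, rfl⟩
    exact (Fin.elim0 (Fin.cast h0' j) : _)
  let i : Fin (maximalIdeal S).spanFinrank := ⟨0, hd0⟩
  have hci : algebraMap S K (c i) ≠ 0 := fun h =>
    rsop_ne_zero hd c hc i ((injective_iff_map_eq_zero _).mp (IsFractionRing.injective S K) _ h)
  -- the chart `T` inside `K`
  haveI : IsDomain (chartRing c i) := isDomain_chart c i hci
  haveI : IsNoetherianRing (chartRing c i) := isNoetherianRing_chart c i
  letI algTK : Algebra (chartRing c i) K := (chartToField c i (algebraMap S K) hci).toAlgebra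
  haveI : IsFractionRing (chartRing c i) K := isFractionRing_chart c i hci
  haveI h𝔭 : (Ideal.span {chartBase c i (c i)}).IsPrime := isPrime_excIdeal hd c hc i
  obtain ⟨O, ψT, hψT, hdomT, hfrac⟩ := exists_valuationSubring_of_span_singleton (K := K)
    (chartBase c i (c i)) (chartBase_ne_zero c i hci) (Ideal.span {chartBase c i (c i)}) rfl
  -- the map `S → O` and domination
  let ψ : S →+* O := ψT.comp (chartBase c i)
  have hψ : ∀ s : S, (ψ s : K) = algebraMap S K s := fun s => by
    show ((ψT (chartBase c i s) : O) : K) = algebraMap S K s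
    rw [hψT]
    exact chartToField_reesChartBase c i (algebraMap S K) hci s
  have hdom : maximalIdeal S ≤ (maximalIdeal O).comap ψ := by
    intro s hs
    rw [Ideal.mem_comap]
    have hs' : chartBase c i s ∈ Ideal.span {chartBase c i (c i)} := by
      rw [← hc] at hs
      exact reesChartBase_mem_span_of_mem c i hs
    exact hdomT hs'
  refine ⟨O, ψ, hψ, hdom, ?_⟩
  -- the tower `κ(S) → T/(x_i) → κ(O)`, with `T/(x_i) ≅ κ(S)[T_j : j ≠ i]`
  haveI : IsDomain (S ⧸ maximalIdeal S) := Ideal.Quotient.isDomain _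
  obtain ⟨f, hf, ⟨e⟩⟩ := exists_chartQuotAlgEquiv hd c hc i
  letI algFT : Algebra (S ⧸ maximalIdeal S) (chartRing c i ⧸ Ideal.span {chartBase c i (c i)}) :=
    f.toAlgebra
  letI algTO : Algebra (chartRing c i ⧸ Ideal.span {chartBase c i (c i)}) (ResidueField O) :=
    (Ideal.quotientMap (maximalIdeal O) ψT hdomT).toAlgebra
  letI algFO : Algebra (S ⧸ maximalIdeal S) (ResidueField O) :=
    (Ideal.quotientMap (maximalIdeal O) ψ hdom).toAlgebra
  haveI : IsScalarTower (S ⧸ maximalIdeal S) (chartRing c i ⧸ Ideal.span {chartBase c i (c i)})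
      (ResidueField O) :=
    IsScalarTower.of_algebraMap_eq fun x => by
      obtain ⟨s, rfl⟩ := Ideal.Quotient.mk_surjective x
      show Ideal.quotientMap (maximalIdeal O) ψ hdom (Ideal.Quotient.mk _ s) =
        Ideal.quotientMap (maximalIdeal O) ψT hdomT (f (Ideal.Quotient.mk _ s))
      rw [hf]
      rfl
  haveI hfrac' : IsFractionRing (chartRing c i ⧸ Ideal.span {chartBase c i (c i)})
      (ResidueField O) := hfrac
  haveI : FaithfulSMul (chartRing c i ⧸ Ideal.span {chartBase c i (c i)}) (ResidueField O) :=
    (faithfulSMul_iff_algebraMap_injective _ _).mpr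
      (IsFractionRing.injective (chartRing c i ⧸ Ideal.span {chartBase c i (c i)}) (ResidueField O))
  haveI hsm1 : Algebra.FormallySmooth (S ⧸ maximalIdeal S)
      (chartRing c i ⧸ Ideal.span {chartBase c i (c i)}) :=
    Algebra.FormallySmooth.of_equiv e
  -- `κ(S) → T/(x_i)` is injective (constants of the polynomial ring)
  haveI : FaithfulSMul (S ⧸ maximalIdeal S) (chartRing c i ⧸ Ideal.span {chartBase c i (c i)}) := by
    refine (faithfulSMul_iff_algebraMap_injective _ _).mpr fun x y hxy => ?_
    apply (MvPolynomial.C_injective {j : Fin (maximalIdeal S).spanFinrank // j ≠ i}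
      (S ⧸ maximalIdeal S))
    apply e.injective
    rw [← MvPolynomial.algebraMap_eq, e.commutes, e.commutes]
    exact hxy
  haveI hsm2 : Algebra.FormallySmooth (chartRing c i ⧸ Ideal.span {chartBase c i (c i)})
      (ResidueField O) :=
    Algebra.FormallySmooth.of_isLocalization
      (nonZeroDivisors (chartRing c i ⧸ Ideal.span {chartBase c i (c i)}))
  refine ⟨Algebra.FormallySmooth.comp (S ⧸ maximalIdeal S)
    (chartRing c i ⧸ Ideal.span {chartBase c i (c i)}) (ResidueField O), ?_⟩
  -- transcendence degrees: `(d - 1) + 0 + 1 = d`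
  haveI : Algebra.IsAlgebraic (chartRing c i ⧸ Ideal.span {chartBase c i (c i)})
      (ResidueField O) :=
    IsLocalization.isAlgebraic (ResidueField O)
      (nonZeroDivisors (chartRing c i ⧸ Ideal.span {chartBase c i (c i)}))
  have h1 : Algebra.trdeg (S ⧸ maximalIdeal S) (chartRing c i ⧸ Ideal.span {chartBase c i (c i)}) =
      (((maximalIdeal S).spanFinrank - 1 : ℕ) : Cardinal) := by
    rw [← e.trdeg_eq, MvPolynomial.trdeg_of_isDomain, Cardinal.mk_fintype, Cardinal.lift_natCast]
    congr 1
    rw [Fintype.card_subtype_compl, Fintype.card_fin, Fintype.card_unique]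
  rw [← trdeg_add_eq (S ⧸ maximalIdeal S) (chartRing c i ⧸ Ideal.span {chartBase c i (c i)})
      (A := ResidueField O),
    trdeg_eq_zero (R := chartRing c i ⧸ Ideal.span {chartBase c i (c i)}) (A := ResidueField O),
    add_zero, h1]
  exact_mod_cast Nat.sub_add_cancel hd0

end Summit.ResolutionOfSingularities.ResolutionOfSingularities.Theorems.SepExcModels.ModelValuationOrder

end
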